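import Summits.QuantumFields.YangMills.Theorems.BalabanUVNodesN16Eq42FirstMomentGaugeCoarse
import Summits.QuantumFields.YangMills.Theorems.BalabanUVNodesN16Eq42PermutationDefectAbelian
import Summits.QuantumFields.BalabanUV.T4Continuum.Support.NE7BlockAverageContourGaugeAbelian
import HarnessLib

/-!
# YM-DAG node N16 (NE3), the located averaging pin (42) ↔ (0.4) — part 10: THE ABELIAN-EXPONENTIAL READING —
# for `W = e^A` in a commutative algebra the corner-block average (42) IS the coarse GAUGE TRANSFORM `W̄ ↦ e^{−Λ} W̄ e^{Λ}` of the
# offset∕centred-block ((0.4)-type) average, up to the relative error `e^{E} − 1`, `E = O(L³δ)` (part 9 §3)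

Cell `pub-ymgap`, width seat `pub-ymgap-dag-n16-w3` (director-ym №197 ∕ HUMAN RULING D-0149), generation 5; part 10 of the W1b sequel (parts 8–9:
p606616 · part 9).  `--kind proof --supports stmt-QuantumFields-20544 --as helper` (K3⁷; count-neutral; 0 def).  `bears_on: R4∕N16`.  Offered on the bus as
hand-out (X9b); filed by this seat absent a taker.

THE POINT.  Parts 2 and 4 gave the abelian-exponential reading of the PERMUTATION part of the pin (`W = expUnit ∘ A` in a commutative complete normed
ℂ-algebra: (42) is `exp` of its linear exponent EXACTLY, tree `AbelianBlockAverage.bavg_expUnit'`).  This file gives it for the CENTRING part, on top of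
part 9's coarse-lattice gauge statement: at the coarse bond `⟨x, x+Le_κ⟩`, `x = q₀ + L•ζ`,
 * ★ `offsetAvg_expUnit`: the (0.4)-TYPE offset-stencil recipe applied to `W = e^A` —
   `exp(Σ_r L^{−d} log[W(Γ_{c,x−s+r})W(c)⁻¹]) · W(Γ_c)` — IS `expUnit([offset-s exponent] + A(Γ_c))` (loop logarithms inside the ball of `log`:
   `Wcx_expUnit` + `B7BlockAvgLog.mlog_exp`, `hol_expUnit`);
 * ★ `bavg_eq_expUnit_mul_offset`: EXACT factorisation `V̄_c = expUnit(X̂ − [offset-s exponent]) · [offset average]`;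
 * `gaugeAct_expUnit_neg`: on a coarse-indexed abelian field the coarse gauge transformation by `u = e^{−Λ}` multiplies the bond `(ζ,κ)` by
   `expUnit(Λ(ζ+e_κ) − Λ(ζ))` (tree `gaugeAct`, (8) p.18);
 * ★★ `norm_bavg_sub_gaugeAct_offset_le`: with part 9's `norm_corner_sub_stencil_sub_coarseAxial_le` (bound `E`) and part 2's `norm_exp_sub_exp_le`,
   `‖V̄_c − (e^{−Λ}·Ō·e^{Λ})(ζ,κ)‖ ≤ ‖(e^{−Λ}·Ō·e^{Λ})(ζ,κ)‖ · (e^{E} − 1)` where `Ō(ζ,κ)` is the offset-stencil average of `W` at `x = q₀ + L•ζ` and `Λ` the coarse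
   tree potential of part 9 — THE CORNER-BLOCK AVERAGE (42) OF AN ABELIAN FIELD IS A COARSE GAUGE TRANSFORM OF THE OFFSET∕CENTRED-BLOCK AVERAGE UP TO THE
   RELATIVE ERROR `e^{E} − 1 = O(L³δ)`.

RELATION TO THE TREE'S EXACT ABELIAN GAUGE IDENTITY (cited, not restated).  `NE7BlockAverageContourGaugeAbelian.bavg_expUnit_eq_gauge` (row NE7) proves that
the abelian (42) is EXACTLY the coarse gauge transform, by `exp` of the TREE POTENTIAL `treePot L A` (block mean of `A(Γ_{y,y+r})`), of the STRAIGHT average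
`exp ∘ Qstraight`.  The same bookkeeping applies to any offset stencil (tree potential of the offset block, straight average over the offset block), so corner
versus offset = [an EXACT coarse gauge factor `exp(Φ − Φ_s)`] ∘ [the straight-average field TRANSLATED by the fine vector `s`]; a translation of a connection is
a gauge only up to the contracted curvature `ι_s F` — at first order exactly the first-moment 1-form `Σ_m (L s_m)•F_{mκ}` of parts 6–9 — and THAT is a gauge only
up to its curl `= O(L|s|₁δ)` per plaquette (part 8 §3).  The bound below is therefore not an artefact of the tree contours of (42) (those are exactly gauge in the
abelian case) but of the block OFFSET itself; it is sharp in order (`ι_s F` is not exact for non-constant curvature).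

HONEST FRAMING.  [folklore] bookkeeping BY NAME over `AbelianBlockAverage` (`bavg_expUnit'`, `hol_expUnit`, `Wcx_expUnit`), `NE7BlockAverageContourGaugeAbelian`
(`expUnit_add`), `B7BlockAvgLog.mlog_exp`, part 2 (`norm_exp_sub_exp_le`), part 9 (`norm_corner_sub_stencil_sub_coarseAxial_le`); commutative coefficient algebra ONLY (the non-abelian statement is part 9 §4 at
the level of exponents); 0 `def`, 0 `sorry`; no printed sentence is a hypothesis; nothing of [Balaban1985Averaging] ∕ [Balaban1987RG1] asserted beyond what the
tree proves; no minimiser; `stub_h7` ∕ the K3⁷ stubs NOT touched; N16 ∕ NE3 NOT discharged; count-neutral (typed 28∕28 · discharged 5∕27 work-bound, A 5∕28 —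
unmoved).  One finite four-torus programme at fixed `ε` — the Yang–Mills mass gap (Clay) is NOT proved by any of this; R4 closes the conditional finite-𝕋⁴ rung
`BalabanLadder.UV` only; nothing continuum ∕ ℝ⁴ ∕ OS.
-/

set_option autoImplicit false

open scoped BigOperators
open NormedSpace Finset

namespace Summit.QuantumFields.YangMills.BalabanUVNodes.N16Eq42CentringGaugeAbelian

open Literature.MathematicalPhysics.QuantumFieldTheory.Balaban1983to89
open B7Prop1Explicit
open Summit.QuantumFields.BalabanUV.T4Continuum.AbelianBlockAverage (bavg_expUnit' hol_expUnit Wcx_expUnit)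
open Summit.QuantumFields.BalabanUV.T4Continuum.NE7BlockAverageContourGaugeAbelian (expUnit_add)
open Summit.QuantumFields.YangMills.BalabanUVNodes.N16Eq42PermutationDefectAbelian (norm_exp_sub_exp_le)
open Summit.QuantumFields.YangMills.BalabanUVNodes.N16Eq42FirstMomentGaugeCoarse (norm_corner_sub_stencil_sub_coarseAxial_le)

noncomputable section

variable {d : ℕ}
variable {𝔸 : Type*} [NormedCommRing 𝔸] [NormedAlgebra ℂ 𝔸] [CompleteSpace 𝔸]

/-! ## §1 The abelian offset-stencil average is `exp` of its linear exponent -/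

/-- **★ THE (0.4)-TYPE OFFSET-STENCIL RECIPE ON AN ABELIAN FIELD `W = e^A` IS `exp` OF ITS LINEAR EXPONENT**: with the loop circulations of the offset
stencil inside the ball of the logarithm (`‖A(Γ_{c,x−s+r} ∪ −Γ_c)‖ < log 2`),
`expUnit(Σ_r L^{−d} • log[W(Γ_{c,x−s+r})W(c)⁻¹]) · W(Γ_c) = expUnit(Σ_r L^{−d} • A(Γ_{c,x−s+r} ∪ −Γ_c) + A(Γ_c))` (`s = 0`: the tree's `bavg_expUnit'`).
[folklore] -/
theorem offsetAvg_expUnit (L : ℕ) (A : Site d → Fin d → 𝔸) (x : Site d) (κ : Fin d) (s : Site d)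
    (hsmall : ∀ r : Fin d → Fin L, ‖asum A x (gammaWord L κ (boxVec L r - s) ++ seg κ (-(L : ℤ)))‖ < Real.log 2) :
    expUnit (∑ r : Fin d → Fin L, (((L : ℝ) ^ d)⁻¹) •
        MatrixLog.mlog ((Wcx L (fun y μ => expUnit (A y μ)) x κ (boxVec L r - s) : 𝔸ˣ) : 𝔸))
      * hol (fun y μ => expUnit (A y μ)) x (seg κ L)
      = expUnit ((∑ r : Fin d → Fin L, (((L : ℝ) ^ d)⁻¹) • asum A x (gammaWord L κ (boxVec L r - s) ++ seg κ (-(L : ℤ))))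
          + asum A x (seg κ L)) := by
  have hlog : ∀ r : Fin d → Fin L,
      MatrixLog.mlog ((Wcx L (fun y μ => expUnit (A y μ)) x κ (boxVec L r - s) : 𝔸ˣ) : 𝔸)
        = asum A x (gammaWord L κ (boxVec L r - s) ++ seg κ (-(L : ℤ))) := by
    intro r
    rw [Wcx_expUnit, val_expUnit, B7BlockAvgLog.mlog_exp (hsmall r)]
  simp_rw [hlog]
  rw [hol_expUnit, expUnit_add]

/-- **★ EXACT FACTORISATION OF (42) ON AN ABELIAN FIELD**: `V̄_c = expUnit(X̂_c − [offset-s exponent]) · [offset-stencil average]` (tree `bavg_expUnit'`: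
`V̄_c = expUnit(X̂_c + A(Γ_c))`). [folklore] -/
theorem bavg_eq_expUnit_mul_offset (L : ℕ) (hL : 1 ≤ L) (A : Site d → Fin d → 𝔸) (x : Site d) (κ : Fin d) (s : Site d)
    (hsmall : ∀ r : Fin d → Fin L, ‖asum A x (gammaWord L κ (boxVec L r) ++ seg κ (-(L : ℤ)))‖ < Real.log 2) :
    bavg L (fun y μ => expUnit (A y μ)) x κ
      = expUnit (Xhat L A x κ
            - ∑ r : Fin d → Fin L, (((L : ℝ) ^ d)⁻¹) • asum A x (gammaWord L κ (boxVec L r - s) ++ seg κ (-(L : ℤ))))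
        * expUnit ((∑ r : Fin d → Fin L, (((L : ℝ) ^ d)⁻¹) • asum A x (gammaWord L κ (boxVec L r - s) ++ seg κ (-(L : ℤ))))
            + asum A x (seg κ L)) := by
  rw [bavg_expUnit' L hL A x κ hsmall, ← expUnit_add]
  congr 1
  abel

/-! ## §2 The coarse gauge transformation and the main estimate -/

/-- **THE COARSE GAUGE TRANSFORMATION BY `u = e^{−Λ}`** on a coarse-indexed abelian field: `(u·V·u⁻¹)(ζ,κ) = expUnit(Λ(ζ+e_κ) − Λ(ζ)) · V(ζ,κ)`
(tree `gaugeAct`, (8) p. 18, on the coarse index lattice). [cite: Balaban1985Averaging, (8) p.18] -/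
theorem gaugeAct_expUnit_neg (Λ : Site d → 𝔸) (V : Site d → Fin d → 𝔸ˣ) (ζ : Site d) (κ : Fin d) :
    gaugeAct (fun z => expUnit (-Λ z)) V ζ κ = expUnit (Λ (ζ + e κ) - Λ ζ) * V ζ κ := by
  unfold gaugeAct
  rw [val_inv_expUnit, neg_neg, mul_comm (expUnit (-Λ ζ)) (V ζ κ), mul_assoc, ← expUnit_add, mul_comm]
  congr 2
  abel

/-- **★★ THE CORNER-BLOCK AVERAGE (42) OF AN ABELIAN FIELD IS A COARSE GAUGE TRANSFORM OF THE OFFSET∕CENTRED-BLOCK AVERAGE, UP TO `e^{E} − 1`.**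
`W = e^A` in a commutative complete normed ℂ-algebra; at the coarse bond `⟨x, x+Le_κ⟩`, `x = q₀ + L•ζ`: loops of both stencils inside the ball of `log`; the flux
moves by `≤ δ` under unit steps within radius `R` of `q₀` (`R ≥ L(3|ζ|₁+2)`, `R ≥ L|ζ|₁ + 2(dL+|s|₁) + L`).  Let `Ō(z,κ′)` be the offset-`s` stencil average of `W` at
`q₀ + L•z` (displayed: `expUnit([offset exponent] + A(Γ_c))`, = the (0.4)-type recipe by `offsetAvg_expUnit`) and `Λ` the coarse tree potential of part 9
(`Λ(z) = asum Θ 0 (treeWord z)`, `Θ(z,κ′) = Σ_m (L s_m)•A(∂p)_{q₀+L•z}(m κ′)`).  Then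
`‖V̄(x,κ) − (e^{−Λ}·Ō·e^{Λ})(ζ,κ)‖ ≤ ‖(e^{−Λ}·Ō·e^{Λ})(ζ,κ)‖ · (exp E − 1)`, `E = (2dL+|s|₁)·L·((2(dL+|s|₁)+L)δ) + |ζ|₁·2L²|s|₁δ` (part 9 §3). [folklore] -/
theorem norm_bavg_sub_gaugeAct_offset_le (L : ℕ) (hL : 1 ≤ L) (A : Site d → Fin d → 𝔸) (q₀ ζ : Site d) (κ : Fin d) (s : Site d)
    (hsmall : ∀ r : Fin d → Fin L, ‖asum A (q₀ + (L : ℤ) • ζ) (gammaWord L κ (boxVec L r) ++ seg κ (-(L : ℤ)))‖ < Real.log 2)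
    {δ : ℝ} (hδ : 0 ≤ δ) {R : ℕ} (hR : L * (3 * l1 ζ + 2) ≤ R) (hR' : L * l1 ζ + (2 * (d * L + l1 s) + L) ≤ R)
    (hLip : ∀ (y : Site d) (m μ ν : Fin d), l1 (y - q₀) ≤ R → ‖asum A (y + e μ) (plaqWord m ν) - asum A y (plaqWord m ν)‖ ≤ δ) :
    ‖((bavg L (fun y μ => expUnit (A y μ)) (q₀ + (L : ℤ) • ζ) κ : 𝔸ˣ) : 𝔸)
        - ((gaugeAct
              (fun z => expUnit (-(asum (fun z' κ' => ∑ m : Fin d, ((L : ℝ) * (s m : ℝ)) • asum A (q₀ + (L : ℤ) • z') (plaqWord m κ'))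
                0 (treeWord z))))
              (fun z κ' => expUnit
                ((∑ r : Fin d → Fin L, (((L : ℝ) ^ d)⁻¹) •
                    asum A (q₀ + (L : ℤ) • z) (gammaWord L κ' (boxVec L r - s) ++ seg κ' (-(L : ℤ))))
                  + asum A (q₀ + (L : ℤ) • z) (seg κ' L)))
              ζ κ : 𝔸ˣ) : 𝔸)‖
      ≤ ‖((gaugeAct
              (fun z => expUnit (-(asum (fun z' κ' => ∑ m : Fin d, ((L : ℝ) * (s m : ℝ)) • asum A (q₀ + (L : ℤ) • z') (plaqWord m κ'))
                0 (treeWord z))))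
              (fun z κ' => expUnit
                ((∑ r : Fin d → Fin L, (((L : ℝ) ^ d)⁻¹) •
                    asum A (q₀ + (L : ℤ) • z) (gammaWord L κ' (boxVec L r - s) ++ seg κ' (-(L : ℤ))))
                  + asum A (q₀ + (L : ℤ) • z) (seg κ' L)))
              ζ κ : 𝔸ˣ) : 𝔸)‖
          * (Real.exp ((2 * (d * L) + l1 s) * L * ((2 * (d * L + l1 s) + L) * δ) + l1 ζ * (2 * (L * δ) * ((L : ℝ) * l1 s))) - 1) := by
  set x : Site d := q₀ + (L : ℤ) • ζ with hx
  set St : 𝔸 := ∑ r : Fin d → Fin L, (((L : ℝ) ^ d)⁻¹) • asum A x (gammaWord L κ (boxVec L r - s) ++ seg κ (-(L : ℤ))) with hSt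
  set Λ : Site d → 𝔸 := fun z => asum (fun z' κ' => ∑ m : Fin d, ((L : ℝ) * (s m : ℝ)) • asum A (q₀ + (L : ℤ) • z') (plaqWord m κ'))
    0 (treeWord z) with hΛ
  have hE := norm_corner_sub_stencil_sub_coarseAxial_le L hL A q₀ ζ κ s hδ hR hR' hLip
  rw [gaugeAct_expUnit_neg, bavg_expUnit' L hL A x κ hsmall, ← expUnit_add, val_expUnit, val_expUnit]
  refine (norm_exp_sub_exp_le _ _).trans (mul_le_mul_of_nonneg_left ?_ (norm_nonneg _))
  have hdiff : Xhat L A x κ + asum A x (seg κ L) - (Λ (ζ + e κ) - Λ ζ + (St + asum A x (seg κ L)))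
      = (Xhat L A x κ - St) - (Λ (ζ + e κ) - Λ ζ) := by abel
  rw [hdiff]
  linarith [Real.exp_le_exp.mpr hE]

end

end Summit.QuantumFields.YangMills.BalabanUVNodes.N16Eq42CentringGaugeAbelian
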